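import Summits.CriticalPhenomena.SAWScalingLimit.Theorems.SAWRenewalTightnessTubeLowerBoundOctantReduction
import Summits.CriticalPhenomena.SAWScalingLimit.Theorems.SAWRenewalTightnessTubeLowerBoundLassoGluing
import Summits.CriticalPhenomena.SAWScalingLimit.Theorems.SAWRenewalTightnessTubeLowerBoundDominoStaircase
import Summits.CriticalPhenomena.SAWScalingLimit.Theorems.SAWRenewalTightnessTubeLowerBoundCeilingOfExponent

/-!
# Crux `TubeLowerBound` (stmt-CriticalPhenomena-4730): the crux from a COUNT CEILING (line `lasso-repair-poly-hw`)

The conditional closure of the crux `SAWRenewalTightness.TubeLowerBound` delivered by the line `Sketch` =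
`lasso-repair-poly-hw` (lead c2, skeleton `Cruxes/TubeLowerBound/Lines/Sketch.lean`), assembled from LANDED stubs only:

* `TubeLowerBound_of_countCeiling` — polynomial Hammersley–Welsh in mass form (`cₙ x_cⁿ ≤ (n+1)^C` for one
  `C ≥ 0`; equivalently a finite enumeration exponent) implies the crux: the lasso inequality
  (`LassoRepair.stub_lassoGluing`, p103890) glues the proved centre-start dominoes with overlaps along a corner
  staircase (`LassoRepair.stub_dominoStaircase`), giving `FirstOctantTubeFloor`; the octant reduction
  (`LiebSimonStar.stub_octantReduction`, p80734) and `tightTubeFloor_iff_crux` give the crux BY NAME.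
* `TubeLowerBound_of_hasEnumerationExponent` — if `cₙ ∼ A μⁿ n^{γ-1}` on `ℤ²` for SOME `γ`
  (`Zd.HasEnumerationExponent 2 1 γ`, BDGS2012 (1.21)), the crux holds (`LassoRepair.stub_ceiling_of_exponent`).
* `TubeLowerBound_of_enumerationExponentConjecture2D` — in particular the registered open conjecture
  `Zd.EnumerationExponentConjecture2D` (`γ = 43/32`, Nienhuis 1982; BDGS2012 §1.5.1 (1.22)) implies the crux.

So the RSW-type FLOOR `TubeLowerBound` is reduced to a pure counting CEILING.  These are conditional results
(the gate records `proof.conditional`); the item stays open until the ceiling itself is proved.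
-/

noncomputable section

namespace Summit.CriticalPhenomena.SAWScalingLimit.Theorems.TubeLowerBound.LassoRepair

open scoped BigOperators Classical
open Literature.Probability.LatticeModels
open Literature.Probability.RandomPlanarGeometry Literature.Probability.RandomPlanarGeometry.SAW
open Summit.CriticalPhenomena.SAWScalingLimit.Theses.SAWRenewalTightness (TubeLowerBound)
open Summit.CriticalPhenomena.SAWScalingLimit.Theorems.TubeLowerBound.LiebSimonStar

/-- **The crux from the count ceiling.**  If `cₙ x_cⁿ ≤ (n+1)^C` for all `n` and one `C ≥ 0` (polynomial
Hammersley–Welsh in mass form), then `TubeLowerBound` holds: lasso staircase of dominoes (`stub_dominoStaircase`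
fed by `stub_lassoGluing`), octant reduction, `TightTubeFloor ↔ TubeLowerBound`. -/
theorem TubeLowerBound_of_countCeiling :
    (∃ C : ℝ, 0 ≤ C ∧ ∀ n : ℕ, (Zd.count 2 n : ℝ) * criticalFugacity ^ n ≤ ((n : ℝ) + 1) ^ C) →
    TubeLowerBound :=
  fun h => tightTubeFloor_iff_crux.1 (stub_octantReduction (stub_dominoStaircase stub_lassoGluing h))

/-- **The crux from ANY enumeration exponent**: if `cₙ ∼ A μⁿ n^{γ−1}` on `ℤ²` for some real `γ`
(`Zd.HasEnumerationExponent 2 1 γ`), then `TubeLowerBound` holds. -/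
theorem TubeLowerBound_of_hasEnumerationExponent {γ : ℝ} (h : Zd.HasEnumerationExponent 2 1 γ) :
    TubeLowerBound :=
  TubeLowerBound_of_countCeiling (stub_ceiling_of_exponent ⟨γ, h⟩)

/-- **The crux from the registered conjecture `γ = 43/32`** (`Zd.EnumerationExponentConjecture2D`, BDGS2012
§1.5.1 (1.22), Nienhuis 1982): its `λ = 1` instance is an enumeration exponent of the strictly self-avoiding walk,
so `TubeLowerBound` follows. -/
theorem TubeLowerBound_of_enumerationExponentConjecture2D (h : Zd.EnumerationExponentConjecture2D) :
    TubeLowerBound :=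
  TubeLowerBound_of_hasEnumerationExponent (h 1 one_pos le_rfl)

end Summit.CriticalPhenomena.SAWScalingLimit.Theorems.TubeLowerBound.LassoRepair

end
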